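import Literature.Probability.RandomPlanarGeometry.CurveSpace
import Literature.Probability.RandomPlanarGeometry.CurveMonotoneReparam
import Mathlib.Topology.Order.IntermediateValue
import Mathlib.Topology.Order.Compact
import Mathlib.Topology.Order.ProjIcc
import Mathlib.Topology.UnitInterval
import Mathlib.Topology.Homeomorph.Lemmas
import Mathlib.Topology.Separation.Hausdorff
import HarnessLib

/-!
# Crux `SAWDevelopingMap.ObservableToSLE` (stmt-CriticalPhenomena-10472) ≡ twin crux
`SAWDefectDecoherence.ObservableToSLER` (stmt-CriticalPhenomena-14005), line `hull-first-retrace`: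
stub `stub_monotoneOfNoRetrace` (M)

Landing target:
`Summits/CriticalPhenomena/SAWScalingLimit/Theorems/SAWDevelopingMapObservableToSLEHullFirstMonotoneOfNoRetrace.lean`
(`--supports stmt-CriticalPhenomena-10472`; the same stub text is registered on stmt-CriticalPhenomena-14005).

Pure topology. If the trace of a curve class `c` is the trace of an injective curve `α` (a simple arc) with the
same starting point, and no representative of `c` *retraces* (times `r < u < t` with `γ r = γ t`, `γ u ≠ γ r`
and the way back `γ [u, t]` inside the trace of the way out `γ [r, u]`), then `c` is the class of `α`.

Proof. Pick a representative `γ` of `c`; `α` is a homeomorphism onto its range (compact to Hausdorff), so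
`f := α⁻¹ ∘ γ : [0,1] → [0,1]` is continuous with `α ∘ f = γ`, `f 0 = 0`, and `f` is onto. If `f` is monotone
then `f 1 = 1` and `γ = α ∘ f` is a monotone reparametrisation of `α`, at reparametrisation distance `0`
(`Curve.reparamDist_eq_zero_of_monotone'`). If `f` is not monotone, three successive extremal points and two
applications of the intermediate value theorem (`exists_retrace_of_lt`) produce a retrace of `γ`.

* `exists_retrace_of_lt` — the real-variable combinatorial core;
* `exists_continuous_lift` — the continuous lift `f = α⁻¹ ∘ γ`;
* `reparamDist_eq_zero_of_comp_monotone` — monotone lifts give reparametrisation distance `0`;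
* `stub_monotoneOfNoRetrace` — the registered stub.
-/

noncomputable section

open Set Filter Topology
open scoped unitInterval
open Literature.Probability.RandomPlanarGeometry

namespace Summit.CriticalPhenomena.SAWScalingLimit.Theorems.ObservableToSLER.HullFirst

/-! ## The real-variable core: a non-monotone continuous function retraces -/

/-- **A continuous function on `[0, 1]` that starts at its minimum and is not monotone retraces.**
If `g` is continuous, `g 0 ≤ g x` on `[0, 1]`, and `g q < g p` for some `0 ≤ p < q ≤ 1`, then there are
`0 ≤ r < u < t ≤ 1` with `g r = g t < g u` such that every value of `g` on `[u, t]` is a value of `g` on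
`[r, u]`. Construction: `w` a minimiser of `g` on `[q, 1]`, `u` a maximiser on `[0, w]`, `t` a minimiser on
`[u, w]`, and `r ∈ [0, u]` with `g r = g t` by the intermediate value theorem. [folklore] -/
theorem exists_retrace_of_lt {g : ℝ → ℝ} (hg : Continuous g) (h0 : ∀ x ∈ Icc (0 : ℝ) 1, g 0 ≤ g x)
    {p q : ℝ} (hp : 0 ≤ p) (hpq : p < q) (hq : q ≤ 1) (hlt : g q < g p) :
    ∃ r u t : ℝ, 0 ≤ r ∧ r < u ∧ u < t ∧ t ≤ 1 ∧ g r = g t ∧ g r < g u ∧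
      ∀ x ∈ Icc u t, ∃ y ∈ Icc r u, g y = g x := by
  -- `w`: a minimiser of `g` on `[q, 1]`
  obtain ⟨w, ⟨hqw, hw1⟩, hw⟩ :=
    isCompact_Icc.exists_isMinOn (nonempty_Icc.2 hq) hg.continuousOn
  rw [isMinOn_iff] at hw
  have h0w : (0 : ℝ) ≤ w := hp.trans (hpq.le.trans hqw)
  -- `u`: a maximiser of `g` on `[0, w]`
  obtain ⟨u, ⟨h0u, huw⟩, hu⟩ :=
    isCompact_Icc.exists_isMaxOn (nonempty_Icc.2 h0w) hg.continuousOn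
  rw [isMaxOn_iff] at hu
  have hgwu : g w < g u :=
    calc g w ≤ g q := hw q (left_mem_Icc.2 hq)
      _ < g p := hlt
      _ ≤ g u := hu p ⟨hp, hpq.le.trans hqw⟩
  have huw' : u < w := lt_of_le_of_ne huw fun h ↦ by rw [h] at hgwu; exact lt_irrefl _ hgwu
  -- `t`: a minimiser of `g` on `[u, w]`
  obtain ⟨t, ⟨hut, htw⟩, ht⟩ :=
    isCompact_Icc.exists_isMinOn (nonempty_Icc.2 huw) hg.continuousOn
  rw [isMinOn_iff] at ht
  have hgtu : g t < g u := (ht w (right_mem_Icc.2 huw)).trans_lt hgwu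
  have hut' : u < t := lt_of_le_of_ne hut fun h ↦ by rw [h] at hgtu; exact lt_irrefl _ hgtu
  -- `r ∈ [0, u]` with `g r = g t`, by the intermediate value theorem
  have ht01 : t ∈ Icc (0 : ℝ) 1 := ⟨h0u.trans hut, htw.trans hw1⟩
  obtain ⟨r, ⟨h0r, hru⟩, hr⟩ :=
    intermediate_value_Icc h0u hg.continuousOn ⟨h0 t ht01, hgtu.le⟩
  have hru' : r < u := lt_of_le_of_ne hru fun h ↦ by
    rw [h] at hr; rw [hr] at hgtu; exact lt_irrefl _ hgtu
  refine ⟨r, u, t, h0r, hru', hut', htw.trans hw1, hr, hr ▸ hgtu, fun x hx ↦ ?_⟩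
  have hx1 : g t ≤ g x := ht x ⟨hx.1, hx.2.trans htw⟩
  have hx2 : g x ≤ g u := hu x ⟨h0u.trans hx.1, hx.2.trans htw⟩
  obtain ⟨y, hy, hyx⟩ := intermediate_value_Icc hru hg.continuousOn ⟨hr ▸ hx1, hx2⟩
  exact ⟨y, hy, hyx⟩

/-! ## The continuous lift through a simple arc -/

/-- **Lifting a curve through a simple arc with the same trace.** If `α` is an injective curve in a Hausdorff
space and `γ` has the same trace, then `γ = α ∘ f` for a continuous `f : [0,1] → [0,1]` (namely
`f = α⁻¹ ∘ γ`, `α` being a homeomorphism onto its range as a continuous injection from a compact space to a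
Hausdorff space). [folklore] -/
theorem exists_continuous_lift {E : Type*} [TopologicalSpace E] [T2Space E] {α γ : Curve E}
    (hα : Function.Injective α) (hrange : α.range = γ.range) :
    ∃ f : I → I, Continuous f ∧ ∀ x, α (f x) = γ x := by
  have hemb : IsClosedEmbedding α := α.continuous.isClosedEmbedding hα
  have hx : ∀ x, γ x ∈ Set.range α := fun x ↦ by
    have h : γ x ∈ γ.range := Curve.mem_range.2 ⟨x, rfl⟩
    rw [← hrange] at h
    exact h
  refine ⟨fun x ↦ hemb.isEmbedding.toHomeomorph.symm ⟨γ x, hx x⟩,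
    hemb.isEmbedding.toHomeomorph.symm.continuous.comp (γ.continuous.subtype_mk hx), fun x ↦ ?_⟩
  have h := congrArg Subtype.val (hemb.isEmbedding.toHomeomorph.apply_symm_apply ⟨γ x, hx x⟩)
  rwa [IsEmbedding.toHomeomorph_apply_coe] at h

/-! ## Monotone lifts are reparametrisations -/

/-- **A monotone continuous reparametrisation is at distance `0`.** If `γ = α ∘ f` with `f : [0,1] → [0,1]`
continuous, monotone, `f 0 = 0`, `f 1 = 1`, then `Curve.reparamDist γ α = 0`: both are monotone continuous
traversals of the arc `V = α ∘ projIcc`, so `Curve.reparamDist_eq_zero_of_monotone'` applies. [folklore] -/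
theorem reparamDist_eq_zero_of_comp_monotone {E : Type*} [PseudoMetricSpace E] {γ α : Curve E}
    {f : I → I} (hfc : Continuous f) (hmono : Monotone f) (hf0 : f 0 = 0) (hf1 : f 1 = 1)
    (hf : ∀ x, α (f x) = γ x) : Curve.reparamDist γ α = 0 := by
  have h01 : (0 : ℝ) ≤ 1 := zero_le_one
  refine Curve.reparamDist_eq_zero_of_monotone' (m := 1) zero_le_one
    (V := fun s ↦ α (projIcc 0 1 zero_le_one s))
    (h₁ := fun s ↦ (f (projIcc 0 1 zero_le_one s) : ℝ))
    (h₂ := fun s ↦ (projIcc 0 1 zero_le_one s : ℝ))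
    (α.continuous.comp (continuous_projIcc (h := h01))).continuousOn
    (continuous_subtype_val.comp (hfc.comp (continuous_projIcc (h := h01))))
    (continuous_subtype_val.comp (continuous_projIcc (h := h01)))
    (fun a b hab ↦ Subtype.coe_le_coe.2 (hmono (monotone_projIcc zero_le_one hab)))
    (fun a b hab ↦ Subtype.coe_le_coe.2 (monotone_projIcc zero_le_one hab))
    ?_ ?_ ?_ ?_ (fun t ↦ ?_) (fun t ↦ ?_)
  · show ((f (projIcc 0 1 zero_le_one 0)) : ℝ) = 0
    rw [projIcc_left]
    exact congrArg Subtype.val hf0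
  · show ((projIcc 0 1 zero_le_one 0 : I) : ℝ) = 0
    rw [projIcc_left]
  · show ((f (projIcc 0 1 zero_le_one 1)) : ℝ) = 1
    rw [projIcc_right]
    exact congrArg Subtype.val hf1
  · show ((projIcc 0 1 zero_le_one 1 : I) : ℝ) = 1
    rw [projIcc_right]
  · show γ t = α (projIcc 0 1 zero_le_one ((f (projIcc 0 1 zero_le_one (t : ℝ))) : ℝ))
    rw [projIcc_val, projIcc_val, hf]
  · show α t = α (projIcc 0 1 zero_le_one ((projIcc 0 1 zero_le_one (t : ℝ)) : ℝ))
    rw [projIcc_val, projIcc_val]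

/-! ## The registered stub -/

/-- **Registered sub-goal `stub_monotoneOfNoRetrace`** (crux items stmt-CriticalPhenomena-10472 and
stmt-CriticalPhenomena-14005, line `hull-first-retrace`, stub M). If the trace of the curve class `c` is the
trace of an injective curve `α` starting at the source of `c`, and no representative of `c` retraces (no times
`r < u < t` with `γ r = γ t`, `γ u ≠ γ r` and `γ '' [u, t] ⊆ γ '' [r, u]`), then `c` is the class of `α`.
Proof: the continuous lift `f = α⁻¹ ∘ γ` of a representative `γ` (`exists_continuous_lift`) fixes `0` and is
onto; if it is monotone it fixes `1` and `γ = α ∘ f` is a reparametrisation of `α`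
(`reparamDist_eq_zero_of_comp_monotone`); otherwise `exists_retrace_of_lt` yields a retrace of `γ`. [folklore] -/
theorem stub_monotoneOfNoRetrace :
    ∀ (c : CurveClass ℂ) (α : Curve ℂ), Function.Injective α → α.range = c.range → α.source = c.source →
      (¬ ∃ γ : Curve ℂ, CurveClass.mk γ = c ∧
        ∃ r u t : unitInterval, r < u ∧ u < t ∧ γ r = γ t ∧ γ u ≠ γ r ∧
          γ '' Set.Icc u t ⊆ γ '' Set.Icc r u) →
      c = CurveClass.mk α := by
  intro c α hα hrange hsrc hno
  obtain ⟨γ, rfl⟩ := CurveClass.surjective_mk c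
  rw [CurveClass.range_mk] at hrange
  rw [CurveClass.source_mk, Curve.source_def, Curve.source_def] at hsrc
  -- the continuous lift `f = α⁻¹ ∘ γ`
  obtain ⟨f, hfc, hf⟩ := exists_continuous_lift hα hrange
  have hf0 : f 0 = 0 := hα ((hf 0).trans hsrc.symm)
  have hfs : Function.Surjective f := fun y ↦ by
    have hy : α y ∈ α.range := Curve.mem_range.2 ⟨y, rfl⟩
    rw [hrange] at hy
    obtain ⟨x, hx⟩ := Curve.mem_range.1 hy
    exact ⟨x, hα ((hf x).trans hx)⟩
  by_cases hmono : Monotone f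
  · -- monotone lift: `γ` is a reparametrisation of `α`
    have hf1 : f 1 = 1 := by
      obtain ⟨x, hx⟩ := hfs 1
      exact le_antisymm unitInterval.le_one' (hx.ge.trans (hmono unitInterval.le_one'))
    exact CurveClass.mk_eq_mk.2 (reparamDist_eq_zero_of_comp_monotone hfc hmono hf0 hf1 hf)
  · -- non-monotone lift: `γ` retraces, contradicting the hypothesis
    exfalso
    apply hno
    obtain ⟨p, q, hpq, hlt⟩ : ∃ p q : I, p ≤ q ∧ f q < f p := by
      by_contra hcon
      refine hmono fun a b hab ↦ ?_
      by_contra hab'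
      exact hcon ⟨a, b, hab, not_le.1 hab'⟩
    have hpq' : p < q := lt_of_le_of_ne hpq (by rintro rfl; exact lt_irrefl _ hlt)
    -- the real extension `g` of `f`
    set g : ℝ → ℝ := fun s ↦ (f (projIcc 0 1 zero_le_one s) : ℝ) with hg_def
    have hg : Continuous g :=
      continuous_subtype_val.comp (hfc.comp (continuous_projIcc (h := zero_le_one)))
    have hgI : ∀ x : I, g x = f x := fun x ↦ by
      simp only [hg_def, projIcc_val]
    have hg0 : ∀ x ∈ Icc (0 : ℝ) 1, g 0 ≤ g x := fun x _ ↦ by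
      have h : g 0 = 0 := by
        rw [show (0 : ℝ) = ((0 : I) : ℝ) from rfl, hgI, hf0]
      rw [h]
      exact unitInterval.nonneg _
    have hlt' : g q < g p := by
      rw [hgI, hgI]
      exact Subtype.coe_lt_coe.2 hlt
    obtain ⟨r, u, t, h0r, hru, hut, ht1, hrt, hru_lt, hsub⟩ :=
      exists_retrace_of_lt hg hg0 p.2.1 (Subtype.coe_lt_coe.2 hpq') q.2.2 hlt'
    -- values of `g` determine values of `γ` on `[0, 1]`
    have key : ∀ x y : I, g x = g y → γ x = γ y := fun x y h ↦ by
      rw [hgI, hgI] at h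
      rw [← hf x, ← hf y, Subtype.ext h]
    have hu1 : u ≤ 1 := hut.le.trans ht1
    have h0u : 0 ≤ u := h0r.trans hru.le
    set R : I := ⟨r, h0r, hru.le.trans hu1⟩
    set U : I := ⟨u, h0u, hu1⟩
    set T : I := ⟨t, h0u.trans hut.le, ht1⟩
    refine ⟨γ, rfl, R, U, T, Subtype.mk_lt_mk.2 hru, Subtype.mk_lt_mk.2 hut, key R T hrt, ?_, ?_⟩
    · intro hUR
      have h1 : f U = f R := hα ((hf U).trans (hUR.trans (hf R).symm))
      have h2 : g u = g r := by
        rw [show u = ((U : I) : ℝ) from rfl, show r = ((R : I) : ℝ) from rfl, hgI, hgI, h1]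
      rw [h2] at hru_lt
      exact lt_irrefl _ hru_lt
    · rintro _ ⟨x, ⟨hUx, hxT⟩, rfl⟩
      obtain ⟨y, ⟨hry, hyu⟩, hyx⟩ :=
        hsub x ⟨Subtype.coe_le_coe.2 hUx, Subtype.coe_le_coe.2 hxT⟩
      exact ⟨⟨y, h0r.trans hry, hyu.trans hu1⟩, ⟨Subtype.mk_le_mk.2 hry, Subtype.mk_le_mk.2 hyu⟩,
        key _ x hyx⟩

end Summit.CriticalPhenomena.SAWScalingLimit.Theorems.ObservableToSLER.HullFirst

end
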